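import Summits.HubbardSuperconductivity.HubbardSuperconductivity.Theorems.BalabanIRBirComplexStableXYRPositivity
import Summits.HubbardSuperconductivity.HubbardSuperconductivity.Theorems.BalabanIRBirComplexStableXYRMultiSlice
import Summits.HubbardSuperconductivity.HubbardSuperconductivity.Theorems.BalabanIRBirComplexStableXYRSplitGlue
import Summits.HubbardSuperconductivity.HubbardSuperconductivity.Theorems.BalabanIRBirComplexStableXYRSpinWave
import Summits.HubbardSuperconductivity.HubbardSuperconductivity.Theorems.BalabanIRBirComplexStableXYEvenPositivity
import Summits.HubbardSuperconductivity.HubbardSuperconductivity.Theorems.BirComplexStableXY.Negative.WitnessTable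
import HarnessLib

/-!
# Line `log-concave-core-bounded-phase` — skeleton S4′ (lead c2) for crux `BalabanIR.BirComplexStableXYR`
# (stmt-HubbardSuperconductivity-14845)

S4′ = lead c1's honest re-cut S3 (two antecedent-free stubs = the crux split along its conjunction) with each stub
SHRUNK to exactly its open content, using what landed in lead c2's cycle 1:

* `stub_complexPositivityR3` — bare real-part positivity `0 < Re Z` for window range `r ≥ 3` only, even
  `L₀ ≤ L ≤ M`, `K ≥ K₀(r,B,c₀)`.  The rest of S3's `stub_complexPositivity` (`r = 2`: `birEven_partitionFunction_pos`;
  `Im Z = 0` for every `r`: (R)-reality `partitionFunction_conj_eq_self`) is discharged by the landed reduction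
  `Theorems.birMulti_complexPositivity_reduction` (p119709, file …RMultiSlice, which also lands the `r`-general slice
  factorisation and the `S`-pseudo-Hermiticity `T* = S T S` of the `(r−1)`-block transfer kernel — the structural
  reason no positivity mechanism exists at `r ≥ 3`).
* `stub_complexSliceOrderHalf` — the SLICE-AVERAGED complex deficit bound AT THE CRUX'S OWN THRESHOLD,
  `Re ∫ D e^{−A} ≤ ½·Re Z`, `D = L⁻⁴ Σ_{x,y}(1 − cos(θ_{x,0} − θ_{y,0})) = 1 − O`, for `r ≥ 2`: given positivity it is EQUIVALENT
  to conjunct 2 of the crux (`O = 1 − D` pointwise), so `crux ⇔ S4′-1 ∧ S4′-2` — the registered content is exactly the open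
  content, no strengthening (S3 registered the pointwise two-point bound with a spin-wave-sized constant; the quantitative
  averaged variant `ComplexSliceDeficit`, `≤ C/(c₀K)·Re Z`, keeps its landed glue `Theorems.stub_splitGlueR3`, p120430;
  Gaussian backbone landed: `birComplexStableXYR_spinWave`, C = 32/c₀).

ENDGAME (proved by lead c2, Theses-free, file `Theorems/BalabanIRBirComplexStableXYRSplitGlueR3.lean` + its append): the glue
`stub_splitGlueHalf : ComplexPositivityR3-body → ComplexSliceOrderHalf-body → crux-body` (`sg_core_avg` with `κ = 1/2`; `Im Z = 0`
by (R)-reality; `r = 2` positivity by `birEven_partitionFunction_pos`), LANDED p120778 (in-file copy `splitGlueHalf'` until the farm has built the module).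
Sorries only in `stub_*` (the two XL stubs); `BirComplexStableXYR_of = stub_splitGlueHalf stub_complexPositivityR3 stub_complexSliceOrderHalf` (up to
`dsimp`) concludes the crux BY NAME.

STATUS (lead c2, cycle 1): both stubs are crux-sized and `stub-blocked` on a theorem that exists neither in the tree
nor in print — the volume-uniform small/large-field multiscale expansion for complex conjugate-paired activities on the
real massless Gaussian backbone (blueprint `Lines/log-concave-core-bounded-phase.md` §3, M2–M5; M0–M1 landed).  Worker
w-pos (stub 1): "stub-blocked: none in tree/Mathlib — the ONE missing theorem is the volume-uniform low-temperature
multiscale (small/large-field cluster) expansion for admissible complex window actions at r ≥ 3: log Z = Σ_X φ_X (real,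
translation-covariant local terms) + R, |Im R| < π/2".  Item-ready `let`-style copies for the planner at the end of the
file: `ComplexPositivityR3`, `ComplexSliceOrderHalf` (equivalent split), `ComplexSliceDeficit` (quantitative variant),
`RealFaceSliceOrder`.
-/

set_option linter.dupNamespace false -- crux workfile namespace `Summit.<S>.<S>.Cruxes…` (D-0017 layout)

noncomputable section

namespace Summit.HubbardSuperconductivity.HubbardSuperconductivity.Cruxes.BirComplexStableXYR.Lines.LogConcaveCoreBoundedPhase

open scoped BigOperators ComplexConjugate
open MeasureTheory Literature.Probability.LatticeModels
open Summit.HubbardSuperconductivity.BirComplexStableXYNegative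
open Summit.HubbardSuperconductivity.HubbardSuperconductivity.Theses.BalabanIR
open Summit.HubbardSuperconductivity.HubbardSuperconductivity.Theorems

/-! ## Registered stubs (S4) -/

/-- **stub (S4-1, XL): real-part positivity of the complex partition function for `r ≥ 3`.**  For every
admissible (R)∧(P) table of window range `r ≥ 3`, `K ≥ K₀(r,B,c₀)` and even `L₀ ≤ L ≤ M`: `0 < Re Z`.
(The `(r−1)`-block transfer kernel is only `S`-pseudo-Hermitian, `birMulti_block_pseudoHerm`; open content:
no dominant conjugate pair / sign change of the real `Z`, uniformly in the volume.) -/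
theorem stub_complexPositivityR3 :
    ∀ (r : ℕ) (B c₀ : ℝ), 3 ≤ r → 0 < c₀ → ∃ K₀ : ℝ, ∃ L₀ : ℕ, ∀ K : ℝ, K₀ ≤ K → ∀ c : Table r, (∀ n ∈ c.support, ∑ w, n w = 0) → c.sum (fun _ a => a) = 0 → normA c ≤ B → (∀ φ : W r → ℝ, c₀ * ∑ w, ∑ w', (1 - Real.cos (φ w - φ w')) ≤ (genF c φ).re) → (∀ n : Freq r, c (fun w => n (w.1, w.2.1, Fin.rev w.2.2)) = (starRingEnd ℂ) (c (-n))) → (∀ n : Freq r, c (fun w => n (Fin.rev w.1, Fin.rev w.2.1, w.2.2)) = c n) → ∀ (L M : ℕ) [NeZero L] [NeZero M], L₀ ≤ L → L ≤ M → Even L → Even M → 0 < (partZ K c L M).re := by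
  sorry

/-- S3's `stub_complexPositivity` (`0 < Re Z ∧ Im Z = 0`, all `r ≥ 2`) from S4-1 by the landed reduction
`birMulti_complexPositivity_reduction` (`r = 2`: `birEven_partitionFunction_pos`; `Im Z = 0`: (R)-reality). -/
theorem complexPositivity :
    ∀ (r : ℕ) (B c₀ : ℝ), 2 ≤ r → 0 < c₀ → ∃ K₀ : ℝ, ∃ L₀ : ℕ, ∀ K : ℝ, K₀ ≤ K → ∀ c : Table r, (∀ n ∈ c.support, ∑ w, n w = 0) → c.sum (fun _ a => a) = 0 → normA c ≤ B → (∀ φ : W r → ℝ, c₀ * ∑ w, ∑ w', (1 - Real.cos (φ w - φ w')) ≤ (genF c φ).re) → (∀ n : Freq r, c (fun w => n (w.1, w.2.1, Fin.rev w.2.2)) = (starRingEnd ℂ) (c (-n))) → (∀ n : Freq r, c (fun w => n (Fin.rev w.1, Fin.rev w.2.1, w.2.2)) = c n) → ∀ (L M : ℕ) [NeZero L] [NeZero M], L₀ ≤ L → L ≤ M → Even L → Even M → 0 < (partZ K c L M).re ∧ (partZ K c L M).im = 0 :=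
  birMulti_complexPositivity_reduction stub_complexPositivityR3

/-- The `r = 2` instance of `complexPositivity` is a theorem for EVERY `K` and every torus with even `M`
((R) ⇒ Osterwalder–Schrader positivity of the two-slice transfer structure: `birEven_partitionFunction_pos`
composed with the table ⇒ functional bridge `timeReflection_functional_of_table`; cf. Disproof §3
`zne_of_R_r2`).  Hence the open content of `stub_complexPositivity` is `r ≥ 3`, where the multi-slice
transfer operator is only pseudo-Hermitian (this is what S4-1 registers). [folklore] -/
theorem complexPositivity_two (c : Table 2)
    (hR : ∀ n : Freq 2, c (fun w => n (w.1, w.2.1, Fin.rev w.2.2)) = (starRingEnd ℂ) (c (-n)))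
    (K : ℝ) (L M : ℕ) [NeZero L] [NeZero M] (hM : Even M) :
    0 < (partZ K c L M).re ∧ (partZ K c L M).im = 0 := by
  have h := birEven_partitionFunction_pos c K L M (timeReflection_functional_of_table 2 c hR) hM
  dsimp only at h
  dsimp only [partZ, action, genF, sh, cube]
  exact ⟨h.1, h.2.1⟩

/-- **`complexPositivity` (hence S4-1) is a face OF the crux** (registering it decomposes nothing: it is implied by
`BirComplexStableXYR` itself with the same thresholds, via the landed hidden-positivity theorem
`birComplexStableXYR_pos` — class closed under `c ↦ conj c(−·)`, real-part table positive, (R)-reality,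
continuity + IVT along the admissible segment).  Recorded for the planner who promotes the stub. [folklore] -/
theorem complexPositivity_of_crux (h : BirComplexStableXYR) :
    ∀ (r : ℕ) (B c₀ : ℝ), 2 ≤ r → 0 < c₀ → ∃ K₀ : ℝ, ∃ L₀ : ℕ, ∀ K : ℝ, K₀ ≤ K → ∀ c : Table r, (∀ n ∈ c.support, ∑ w, n w = 0) → c.sum (fun _ a => a) = 0 → normA c ≤ B → (∀ φ : W r → ℝ, c₀ * ∑ w, ∑ w', (1 - Real.cos (φ w - φ w')) ≤ (genF c φ).re) → (∀ n : Freq r, c (fun w => n (w.1, w.2.1, Fin.rev w.2.2)) = (starRingEnd ℂ) (c (-n))) → (∀ n : Freq r, c (fun w => n (Fin.rev w.1, Fin.rev w.2.1, w.2.2)) = c n) → ∀ (L M : ℕ) [NeZero L] [NeZero M], L₀ ≤ L → L ≤ M → Even L → Even M → 0 < (partZ K c L M).re ∧ (partZ K c L M).im = 0 := by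
  intro r B c₀ hr hc₀
  obtain ⟨K₀, L₀, H⟩ := birComplexStableXYR_pos h r B c₀ hr hc₀
  refine ⟨K₀, L₀, ?_⟩
  intro K hK c hU1 hN hA hC hR hP L M _ _ hL0 hLM hLe hMe
  have key := H K hK c hU1 hN hA hC hR hP L M hL0 hLM hLe hMe
  dsimp only at key
  dsimp only [partZ, action, genF, sh, cube]
  exact ⟨key.1, key.2.1⟩

/-- **stub (S4′-2, XL): the slice-averaged complex deficit bound at the crux's own threshold.**  For every
admissible (R)∧(P) table, `K ≥ K₀(r,B,c₀)` and even `L₀ ≤ L ≤ M`: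
`Re ∫ D e^{−A} ≤ ½ · Re Z` with `D(θ) = L⁻⁴ Σ_x Σ_y (1 − cos(θ_{x,0} − θ_{y,0})) = 1 − O(θ)` — given positivity this is
EQUIVALENT to conjunct 2 of the crux (so `crux ⇔ S4′-1 ∧ S4′-2`, no strengthening); every expansion delivers the stronger
spin-wave-sized `C/(c₀K)` (quantitative variant `ComplexSliceDeficit`, glue `Theorems.stub_splitGlueR3`, p120430). -/
theorem stub_complexSliceOrderHalf :
    ∀ (r : ℕ) (B c₀ : ℝ), 2 ≤ r → 0 < c₀ → ∃ K₀ : ℝ, ∃ L₀ : ℕ, ∀ K : ℝ, K₀ ≤ K → ∀ c : Table r, (∀ n ∈ c.support, ∑ w, n w = 0) → c.sum (fun _ a => a) = 0 → normA c ≤ B → (∀ φ : W r → ℝ, c₀ * ∑ w, ∑ w', (1 - Real.cos (φ w - φ w')) ≤ (genF c φ).re) → (∀ n : Freq r, c (fun w => n (w.1, w.2.1, Fin.rev w.2.2)) = (starRingEnd ℂ) (c (-n))) → (∀ n : Freq r, c (fun w => n (Fin.rev w.1, Fin.rev w.2.1, w.2.2)) = c n) → ∀ (L M : ℕ) [NeZero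 L] [NeZero M], L₀ ≤ L → L ≤ M → Even L → Even M → (∫ θ in cube L M, (((∑ x : TorusSite 2 L, ∑ y : TorusSite 2 L, (1 - Real.cos (θ (x, 0) - θ (y, 0)))) / (L : ℝ) ^ 4 : ℝ) : ℂ) * Complex.exp (-(action K c L M θ))).re ≤ (1/2 : ℝ) * (partZ K c L M).re := by
  sorry

/-! ## The glue (LANDED, Theses-free, file `Theorems/BalabanIRBirComplexStableXYRSplitGlueR3.lean`, lead c2):
`Theorems.stub_splitGlueHalf` = `Theorems.birComplexStableXYR_of_rePos3_of_sliceOrderHalf` (p120778; equivalent split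
`ComplexPositivityR3 → ComplexSliceOrderHalf → crux`, `sg_core_avg` with `κ = 1/2`) and the quantitative variant
`Theorems.stub_splitGlueR3` = `Theorems.birComplexStableXYR_of_rePos3_of_sliceDeficit` (p120430;
`ComplexPositivityR3 → ComplexSliceDeficit → crux`).  Below: a verbatim in-file copy of the landed proofs (primed names), used by
the composition so that this workfile elaborates before the farm has built the new module; sorries = the two XL stubs only. -/

section LandedGlueCopy
open Complex

/-- (In-file copy of the LANDED `Theorems.sg_core_avg`, p120430 — kept until the farm has built the module; then replace this
section by `import …Theorems.BalabanIRBirComplexStableXYRSplitGlueR3`.)  **Core of the sharpened glue (weight abstract).**  For a continuous weight `wt` of modulus `≤ 1` on the cube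
with `Z := ∫ wt`, `0 < Re Z`, `Im Z = 0`, and the slice-averaged deficit bound
`Re ∫ (L⁻⁴ Σ_{x,y} (1 − cos(θ_{x,0} − θ_{y,0})))·wt ≤ κ·Re Z` with `κ ≤ 1/2`: `Z ≠ 0` and `Re(∫ O·wt / Z) ≥ 1/2`
for the slice-order observable `O = |Σ_x e^{iθ_{x,0}}|²/L⁴ = 1 − D`. [folklore] -/
theorem sg_core_avg' (L M : ℕ) [NeZero L] [NeZero M] (wt : ((TorusSite 2 L × ZMod M) → ℝ) → ℂ)
    (hwc : Continuous wt) (hwb : ∀ θ, ‖wt θ‖ ≤ 1) {κ : ℝ} (hκ : κ ≤ 1 / 2)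
    (hZpos : 0 < (∫ θ in Set.pi Set.univ (fun _ => Set.Icc (0:ℝ) (2 * Real.pi)), wt θ).re)
    (hZim : (∫ θ in Set.pi Set.univ (fun _ => Set.Icc (0:ℝ) (2 * Real.pi)), wt θ).im = 0)
    (hdef : (∫ θ in Set.pi Set.univ (fun _ => Set.Icc (0:ℝ) (2 * Real.pi)),
        (((∑ x : TorusSite 2 L, ∑ y : TorusSite 2 L, (1 - Real.cos (θ (x, 0) - θ (y, 0)))) / (L : ℝ) ^ 4 : ℝ) : ℂ)
          * wt θ).re ≤
        κ * (∫ θ in Set.pi Set.univ (fun _ => Set.Icc (0:ℝ) (2 * Real.pi)), wt θ).re) :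
    (∫ θ in Set.pi Set.univ (fun _ => Set.Icc (0:ℝ) (2 * Real.pi)), wt θ) ≠ 0 ∧
    (1/2 : ℝ) ≤ ((∫ θ in Set.pi Set.univ (fun _ => Set.Icc (0:ℝ) (2 * Real.pi)),
        ((‖∑ x : TorusSite 2 L, cexp (I * (θ (x, 0) : ℂ))‖ ^ 2 / (L : ℝ) ^ 4 : ℝ) : ℂ) * wt θ) /
      (∫ θ in Set.pi Set.univ (fun _ => Set.Icc (0:ℝ) (2 * Real.pi)), wt θ)).re := by
  set cube : Set ((TorusSite 2 L × ZMod M) → ℝ) := Set.pi Set.univ (fun _ => Set.Icc (0:ℝ) (2 * Real.pi))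
    with hcube
  set Z : ℂ := ∫ θ in cube, wt θ with hZ
  set D : ((TorusSite 2 L × ZMod M) → ℝ) → ℝ := fun θ =>
    (∑ x : TorusSite 2 L, ∑ y : TorusSite 2 L, (1 - Real.cos (θ (x, 0) - θ (y, 0)))) / (L : ℝ) ^ 4 with hD
  have hcard : (Fintype.card (TorusSite 2 L) : ℝ) = (L : ℝ) ^ 2 := by simp [TorusSite, ZMod.card]
  have hL : (0 : ℝ) < L := by exact_mod_cast Nat.pos_of_ne_zero (NeZero.ne L)
  -- integrability
  have hint1 : Integrable (fun θ => (1 : ℂ) * wt θ) (volume.restrict cube) :=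
    sg_integrable_mul_weight wt hwc hwb (fun _ => (1 : ℂ)) continuous_const 1 (fun _ => by simp)
  have hint0 : Integrable wt (volume.restrict cube) := by simpa using hint1
  have hintD : Integrable (fun θ => ((D θ : ℝ) : ℂ) * wt θ) (volume.restrict cube) := by
    refine sg_integrable_mul_weight wt hwc hwb _ ?_ 2 (fun θ => ?_)
    · refine Complex.continuous_ofReal.comp ?_
      refine Continuous.div_const ?_ _
      exact continuous_finsetSum _ fun x _ => continuous_finsetSum _ fun y _ =>
        continuous_const.sub (Real.continuous_cos.comp ((continuous_apply _).sub (continuous_apply _)))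
    · have h0 : 0 ≤ D θ := div_nonneg (Finset.sum_nonneg fun x _ => Finset.sum_nonneg fun y _ =>
        sub_nonneg.2 (Real.cos_le_one _)) (by positivity)
      have h1 : D θ ≤ 2 := by
        have hL4 : (0 : ℝ) < (L : ℝ) ^ 4 := by positivity
        change (∑ x : TorusSite 2 L, ∑ y : TorusSite 2 L, (1 - Real.cos (θ (x, 0) - θ (y, 0)))) /
          (L : ℝ) ^ 4 ≤ 2
        rw [div_le_iff₀ hL4]
        calc (∑ x : TorusSite 2 L, ∑ y : TorusSite 2 L, (1 - Real.cos (θ (x, 0) - θ (y, 0))))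
            ≤ ∑ _x : TorusSite 2 L, ∑ _y : TorusSite 2 L, (2 : ℝ) :=
              Finset.sum_le_sum fun x _ => Finset.sum_le_sum fun y _ => by
                linarith [Real.neg_one_le_cos (θ (x, 0) - θ (y, 0))]
          _ = 2 * (L : ℝ) ^ 4 := by
              simp only [Finset.sum_const, Finset.card_univ, nsmul_eq_mul, hcard]
              ring
      rw [Complex.norm_real, Real.norm_eq_abs, abs_of_nonneg h0]
      exact h1
  -- the numerator identity `∫ O·wt = Z − ∫ D·wt`
  have hpt : ∀ θ : (TorusSite 2 L × ZMod M) → ℝ,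
      (((‖∑ x : TorusSite 2 L, cexp (I * (θ (x, 0) : ℂ))‖ ^ 2 / (L : ℝ) ^ 4 : ℝ)) : ℂ) * wt θ =
        wt θ - ((D θ : ℝ) : ℂ) * wt θ := by
    intro θ
    rw [sg_sliceObs_eq L (fun x => θ (x, 0))]
    simp only [hD]
    push_cast
    ring
  have hnum : ∫ θ in cube, (((‖∑ x : TorusSite 2 L, cexp (I * (θ (x, 0) : ℂ))‖ ^ 2 /
        (L : ℝ) ^ 4 : ℝ)) : ℂ) * wt θ = Z - ∫ θ in cube, ((D θ : ℝ) : ℂ) * wt θ := by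
    simp_rw [hpt]
    exact integral_sub hint0 hintD
  have hDre : (∫ θ in cube, ((D θ : ℝ) : ℂ) * wt θ).re ≤ κ * Z.re := hdef
  have hre_main : (1 - κ) * Z.re ≤
      (∫ θ in cube, (((‖∑ x : TorusSite 2 L, cexp (I * (θ (x, 0) : ℂ))‖ ^ 2 /
        (L : ℝ) ^ 4 : ℝ)) : ℂ) * wt θ).re := by
    rw [hnum, Complex.sub_re]
    linarith
  -- conclude
  have hZne : Z ≠ 0 := fun h => by rw [h, Complex.zero_re] at hZpos; exact lt_irrefl _ hZpos
  refine ⟨hZne, ?_⟩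
  have hZeq : Z = ((Z.re : ℝ) : ℂ) := Complex.ext (by simp) (by simp [hZim])
  rw [hZeq, Complex.div_ofReal_re, le_div_iff₀ hZpos]
  nlinarith [hZpos, hre_main, hκ]

/-- (In-file copy of the LANDED `Theorems.stub_splitGlueHalf` = `Theorems.birComplexStableXYR_of_rePos3_of_sliceOrderHalf`,
p120778.)  **The equivalent split's glue**: child 1 = `ComplexPositivityR3` (`0 < Re Z`, `r ≥ 3`), child 2 =
`ComplexSliceOrderHalf` — the slice-averaged deficit bound with the crux's OWN threshold, `Re ∫ D e^{−A} ≤ ½ Re Z` (`r ≥ 2`),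
which given positivity is EQUIVALENT to conjunct 2 of the crux (`O = 1 − D`), so that `crux ⇔ child 1 ∧ child 2` (hidden
positivity for `⇒`).  Conclusion: the body of `BalabanIR.BirComplexStableXYR` (rev 11).  Thresholds `K₀ = max (max K₀¹ K₀²) 0`,
`L₀ = max L₀¹ L₀²`. [folklore] -/
theorem splitGlueHalf' :
    (∀ (r : ℕ) (B c₀ : ℝ), 3 ≤ r → 0 < c₀ → ∃ K₀ : ℝ, ∃ L₀ : ℕ, ∀ K : ℝ, K₀ ≤ K → ∀ c : ((Fin r × Fin r × Fin r) → ℤ) →₀ ℂ, (∀ n ∈ c.support, ∑ w, n w = 0) → c.sum (fun _ a => a) = 0 → c.sum (fun n a => ‖a‖ * Real.exp (∑ w, |(n w : ℝ)|)) ≤ B → (∀ φ : (Fin r × Fin r × Fin r) → ℝ, c₀ * ∑ w, ∑ w', (1 - Real.cos (φ w - φ w')) ≤ (c.sum (fun n a => a * cexp (I * ((∑ w, (n w : ℝ) * φ w : ℝ) : ℂ)))).re) → (∀ n : (Fin r × Fin r × Fin r) → ℤ, c (fun w => n (w.1, w.2.1, Fin.rev w.2.2)) = conj (c (-n))) → (∀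 n : (Fin r × Fin r × Fin r) → ℤ, c (fun w => n (Fin.rev w.1, Fin.rev w.2.1, w.2.2)) = c n) → ∀ (L M : ℕ) [NeZero L] [NeZero M], L₀ ≤ L → L ≤ M → Even L → Even M → let sh : (TorusSite 2 L × ZMod M) → (Fin r × Fin r × Fin r) → (TorusSite 2 L × ZMod M) := fun s w => (s.1 + ![((w.1 : ℕ) : ZMod L), ((w.2.1 : ℕ) : ZMod L)], s.2 + ((w.2.2 : ℕ) : ZMod M)); let F := fun (φ : (Fin r × Fin r × Fin r) → ℝ) => c.sum (fun n a => a * cexp (I * ((∑ w, (n w : ℝ) * φ w : ℝ) : ℂ))); let A : ((TorusSite 2 L × ZMod M) → ℝ) → ℂ := fun θ => (K : ℂ) * ∑ s, F (fun w => θ (sh s w)); let cube : Set ((TorusSite 2 L × ZMod M) → ℝ) := Set.pi Set.univ (fun _ => Set.Icc (0:ℝ) (2 * Real.pi)); let Z := ∫ θ in cube, cexp (-(A θ)); 0 < Z.re) →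
    (∀ (r : ℕ) (B c₀ : ℝ), 2 ≤ r → 0 < c₀ → ∃ K₀ : ℝ, ∃ L₀ : ℕ, ∀ K : ℝ, K₀ ≤ K → ∀ c : ((Fin r × Fin r × Fin r) → ℤ) →₀ ℂ, (∀ n ∈ c.support, ∑ w, n w = 0) → c.sum (fun _ a => a) = 0 → c.sum (fun n a => ‖a‖ * Real.exp (∑ w, |(n w : ℝ)|)) ≤ B → (∀ φ : (Fin r × Fin r × Fin r) → ℝ, c₀ * ∑ w, ∑ w', (1 - Real.cos (φ w - φ w')) ≤ (c.sum (fun n a => a * cexp (I * ((∑ w, (n w : ℝ) * φ w : ℝ) : ℂ)))).re) → (∀ n : (Fin r × Fin r × Fin r) → ℤ, c (fun w => n (w.1, w.2.1, Fin.rev w.2.2)) = conj (c (-n))) → (∀ n : (Fin r × Fin r × Fin r) → ℤ, c (fun w => n (Fin.rev w.1, Fin.rev w.2.1, w.2.2)) = c n) → ∀ (L M : ℕ) [NeZero L] [NeZero M], L₀ ≤ L → L ≤ M → Even L → Even M → let sh : (TorusSite 2 L × ZMod M) → (Fin r × Fin r × Fin r) → (TorusSite 2 L × ZMod M) := fun s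 w => (s.1 + ![((w.1 : ℕ) : ZMod L), ((w.2.1 : ℕ) : ZMod L)], s.2 + ((w.2.2 : ℕ) : ZMod M)); let F := fun (φ : (Fin r × Fin r × Fin r) → ℝ) => c.sum (fun n a => a * cexp (I * ((∑ w, (n w : ℝ) * φ w : ℝ) : ℂ))); let A : ((TorusSite 2 L × ZMod M) → ℝ) → ℂ := fun θ => (K : ℂ) * ∑ s, F (fun w => θ (sh s w)); let cube : Set ((TorusSite 2 L × ZMod M) → ℝ) := Set.pi Set.univ (fun _ => Set.Icc (0:ℝ) (2 * Real.pi)); let Z := ∫ θ in cube, cexp (-(A θ)); (∫ θ in cube, (((∑ x : TorusSite 2 L, ∑ y : TorusSite 2 L, (1 - Real.cos (θ (x, 0) - θ (y, 0)))) / (L : ℝ) ^ 4 : ℝ) : ℂ) * cexp (-(A θ))).re ≤ (1/2 : ℝ) * Z.re) →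
    ∀ (r : ℕ) (B c₀ : ℝ), 2 ≤ r → 0 < c₀ → ∃ K₀ : ℝ, ∃ L₀ : ℕ, ∀ K : ℝ, K₀ ≤ K → ∀ c : ((Fin r × Fin r × Fin r) → ℤ) →₀ ℂ, (∀ n ∈ c.support, ∑ w, n w = 0) → c.sum (fun _ a => a) = 0 → c.sum (fun n a => ‖a‖ * Real.exp (∑ w, |(n w : ℝ)|)) ≤ B → (∀ φ : (Fin r × Fin r × Fin r) → ℝ, c₀ * ∑ w, ∑ w', (1 - Real.cos (φ w - φ w')) ≤ (c.sum (fun n a => a * cexp (I * ((∑ w, (n w : ℝ) * φ w : ℝ) : ℂ)))).re) → (∀ n : (Fin r × Fin r × Fin r) → ℤ, c (fun w => n (w.1, w.2.1, Fin.rev w.2.2)) = conj (c (-n))) → (∀ n : (Fin r × Fin r × Fin r) → ℤ, c (fun w => n (Fin.rev w.1, Fin.rev w.2.1, w.2.2)) = c n) → ∀ (L M : ℕ) [NeZero L] [NeZero M], L₀ ≤ L → L ≤ M → Even L → Even M → let sh : (TorusSite 2 L × ZMod M) → (Fin r × Fin r × Fin r) → (TorusSite 2 L × ZMod M) := fun s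 w => (s.1 + ![((w.1 : ℕ) : ZMod L), ((w.2.1 : ℕ) : ZMod L)], s.2 + ((w.2.2 : ℕ) : ZMod M)); let F := fun (φ : (Fin r × Fin r × Fin r) → ℝ) => c.sum (fun n a => a * cexp (I * ((∑ w, (n w : ℝ) * φ w : ℝ) : ℂ))); let A : ((TorusSite 2 L × ZMod M) → ℝ) → ℂ := fun θ => (K : ℂ) * ∑ s, F (fun w => θ (sh s w)); let cube : Set ((TorusSite 2 L × ZMod M) → ℝ) := Set.pi Set.univ (fun _ => Set.Icc (0:ℝ) (2 * Real.pi)); let Z := ∫ θ in cube, cexp (-(A θ)); let O := fun (θ : (TorusSite 2 L × ZMod M) → ℝ) => ‖∑ x : TorusSite 2 L, cexp (I * (θ (x, 0) : ℂ))‖ ^ 2 / (L : ℝ) ^ 4; Z ≠ 0 ∧ (1/2 : ℝ) ≤ ((∫ θ in cube, (O θ : ℂ) * cexp (-(A θ))) / Z).re := by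
  intro h1 h2 r B c₀ hr hc₀
  -- positivity `0 < Re Z` for every `r ≥ 2` (thresholds `K₅, L₅`)
  have hpos : ∃ K₀ : ℝ, ∃ L₀ : ℕ, ∀ K : ℝ, K₀ ≤ K → ∀ c : ((Fin r × Fin r × Fin r) → ℤ) →₀ ℂ, (∀ n ∈ c.support, ∑ w, n w = 0) → c.sum (fun _ a => a) = 0 → c.sum (fun n a => ‖a‖ * Real.exp (∑ w, |(n w : ℝ)|)) ≤ B → (∀ φ : (Fin r × Fin r × Fin r) → ℝ, c₀ * ∑ w, ∑ w', (1 - Real.cos (φ w - φ w')) ≤ (c.sum (fun n a => a * cexp (I * ((∑ w, (n w : ℝ) * φ w : ℝ) : ℂ)))).re) → (∀ n : (Fin r × Fin r × Fin r) → ℤ, c (fun w => n (w.1, w.2.1, Fin.rev w.2.2)) = conj (c (-n))) → (∀ n : (Fin r × Fin r × Fin r) → ℤ, c (fun w => n (Fin.rev w.1, Fin.rev w.2.1, w.2.2)) = c n) → ∀ (L M : ℕ) [NeZero L] [NeZero M], L₀ ≤ L → L ≤ M → Even L → Even M → let sh : (TorusSite 2 L × ZMod M) → (Fin r × Fin r ×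 Fin r) → (TorusSite 2 L × ZMod M) := fun s w => (s.1 + ![((w.1 : ℕ) : ZMod L), ((w.2.1 : ℕ) : ZMod L)], s.2 + ((w.2.2 : ℕ) : ZMod M)); let F := fun (φ : (Fin r × Fin r × Fin r) → ℝ) => c.sum (fun n a => a * cexp (I * ((∑ w, (n w : ℝ) * φ w : ℝ) : ℂ))); let A : ((TorusSite 2 L × ZMod M) → ℝ) → ℂ := fun θ => (K : ℂ) * ∑ s, F (fun w => θ (sh s w)); let cube : Set ((TorusSite 2 L × ZMod M) → ℝ) := Set.pi Set.univ (fun _ => Set.Icc (0:ℝ) (2 * Real.pi)); let Z := ∫ θ in cube, cexp (-(A θ)); 0 < Z.re := by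
    rcases (show r = 2 ∨ 3 ≤ r by omega) with rfl | h3r
    · refine ⟨0, 0, ?_⟩
      intro K _ c _ _ _ _ hR _ L M _ _ _ _ _ hM
      have h := birEven_partitionFunction_pos c K L M (timeReflection_functional_of_table 2 c hR) hM
      exact h.1
    · exact h1 r B c₀ h3r hc₀
  obtain ⟨K₅, L₅, H5⟩ := hpos
  obtain ⟨K₆, L₆, H6⟩ := h2 r B c₀ hr hc₀
  refine ⟨max (max K₅ K₆) 0, max L₅ L₆, ?_⟩
  intro K hK c hU1 hN hA hC hR hP L M _ _ hL0 hLM hLe hMe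
  have hK5 : K₅ ≤ K := le_trans (le_trans (le_max_left _ _) (le_max_left _ _)) hK
  have hK6 : K₆ ≤ K := le_trans (le_trans (le_max_right _ _) (le_max_left _ _)) hK
  have hK0 : 0 ≤ K := le_trans (le_max_right _ _) hK
  have hL5 : L₅ ≤ L := le_trans (le_max_left _ _) hL0
  have hL6 : L₆ ≤ L := le_trans (le_max_right _ _) hL0
  have p5 := H5 K hK5 c hU1 hN hA hC hR hP L M hL5 hLM hLe hMe
  have p6 := H6 K hK6 c hU1 hN hA hC hR hP L M hL6 hLM hLe hMe
  have hZreal := partitionFunction_conj_eq_self r c K L M (timeReflection_functional_of_table r c hR)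
  dsimp only at p5 p6 hC hZreal ⊢
  have hZim := Complex.conj_eq_iff_im.mp hZreal
  exact sg_core_avg' L M _ (sg_continuous_weight K c _) (sg_norm_weight_le_one hK0 hc₀.le c hC _) le_rfl
    p5 hZim p6

end LandedGlueCopy

/-- **Composition (S4′): the line closes the crux BY NAME modulo its registered stubs** — the glue applied to the
two XL stubs (each converted from the `WitnessTable` vocabulary `genF/sh/action/cube/partZ/normA` to the crux's
`let`-vocabulary by `dsimp only`). -/
theorem BirComplexStableXYR_of : BirComplexStableXYR := by
  refine splitGlueHalf' ?_ ?_
  · intro r B c₀ hr hc₀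
    obtain ⟨K₀, L₀, H⟩ := stub_complexPositivityR3 r B c₀ hr hc₀
    refine ⟨K₀, L₀, ?_⟩
    intro K hK c hU1 hN hA hC hR hP L M _ _ hL0 hLM hLe hMe
    have key := H K hK c hU1 hN hA hC hR hP L M hL0 hLM hLe hMe
    dsimp only [partZ, action, genF, sh, cube] at key
    dsimp only
    exact key
  · intro r B c₀ hr hc₀
    obtain ⟨K₀, L₀, H⟩ := stub_complexSliceOrderHalf r B c₀ hr hc₀
    refine ⟨K₀, L₀, ?_⟩
    intro K hK c hU1 hN hA hC hR hP L M _ _ hL0 hLM hLe hMe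
    have key := H K hK c hU1 hN hA hC hR hP L M hL0 hLM hLe hMe
    dsimp only [partZ, action, genF, sh, cube] at key
    dsimp only
    exact key

/-! ## Item-ready statements for the planner (S4′ `promote-stub` hand-back)

Self-contained (`let`-style, crux vocabulary verbatim — copy the bodies as item signatures):
`ComplexPositivityR3` = stub S4′-1 (`r ≥ 3` real-part positivity); `ComplexSliceOrderHalf` = stub S4′-2 (slice-averaged
complex deficit `≤ ½ Re Z`, `r ≥ 2`; EQUIVALENT split: glue `Theorems.stub_splitGlueHalf` =
`Theorems.birComplexStableXYR_of_rePos3_of_sliceOrderHalf`); `ComplexSliceDeficit` = its quantitative variant (`≤ C/(c₀K)·Re Z`;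
glue `Theorems.stub_splitGlueR3` = `Theorems.birComplexStableXYR_of_rePos3_of_sliceDeficit`, p120430); `RealFaceSliceOrder` =
lead a2's P4 CONCLUSION (positive modulus measure `e^{−Re A}dθ`; no (R), (P), parity needed; recommended FIRST promoted item:
Literature-grade, Hubbard-independent slice LRO for real coercive finite-range `U(1)` window actions without RP / Ginibre).
The coarse S3 glue `Theorems.birComplexStableXYR_of_positivity_of_deficit` (…SplitGlue, p118048) remains valid. -/

/-- Item-ready form of stub S4′-1 (real-part positivity of the complex partition function, `r ≥ 3`). -/
def ComplexPositivityR3 : Prop :=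
  ∀ (r : ℕ) (B c₀ : ℝ), 3 ≤ r → 0 < c₀ → ∃ K₀ : ℝ, ∃ L₀ : ℕ, ∀ K : ℝ, K₀ ≤ K → ∀ c : ((Fin r × Fin r × Fin r) → ℤ) →₀ ℂ, (∀ n ∈ c.support, ∑ w, n w = 0) → c.sum (fun _ a => a) = 0 → c.sum (fun n a => ‖a‖ * Real.exp (∑ w, |(n w : ℝ)|)) ≤ B → (∀ φ : (Fin r × Fin r × Fin r) → ℝ, c₀ * ∑ w, ∑ w', (1 - Real.cos (φ w - φ w')) ≤ ((fun (φ : (Fin r × Fin r × Fin r) → ℝ) => c.sum (fun n a => a * Complex.exp (Complex.I * ((∑ w, (n w : ℝ) * φ w : ℝ) : ℂ)))) φ).re) → (∀ n : (Fin r × Fin r × Fin r) → ℤ, c (fun w => n (w.1, w.2.1, Fin.rev w.2.2)) = (starRingEnd ℂ) (c (-n))) → (∀ n : (Fin r × Fin r × Fin r) → ℤ, c (fun w => n (Fin.rev w.1, Fin.rev w.2.1, w.2.2)) = c n) → ∀ (L M : ℕ) [NeZero L] [NeZero M], L₀ ≤ L → L ≤ M → Even L → Even M → let sh : (Literature.Probability.LatticeModels.TorusSite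 2 L × ZMod M) → (Fin r × Fin r × Fin r) → (Literature.Probability.LatticeModels.TorusSite 2 L × ZMod M) := fun s w => (s.1 + ![((w.1 : ℕ) : ZMod L), ((w.2.1 : ℕ) : ZMod L)], s.2 + ((w.2.2 : ℕ) : ZMod M)); let F : ((Fin r × Fin r × Fin r) → ℝ) → ℂ := fun (φ : (Fin r × Fin r × Fin r) → ℝ) => c.sum (fun n a => a * Complex.exp (Complex.I * ((∑ w, (n w : ℝ) * φ w : ℝ) : ℂ))); let A : ((Literature.Probability.LatticeModels.TorusSite 2 L × ZMod M) → ℝ) → ℂ := fun θ => (K : ℂ) * ∑ s : (Literature.Probability.LatticeModels.TorusSite 2 L × ZMod M), F (fun w => θ (sh s w)); let cube : Set ((Literature.Probability.LatticeModels.TorusSite 2 L × ZMod M) → ℝ) := Set.pi Set.univ (fun _ => Set.Icc (0:ℝ) (2 * Real.pi)); let Z : ℂ := MeasureTheory.integral (MeasureTheory.volume.restrict cube) (fun θ => Complex.exp (-(A θ))); 0 < Z.re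

/-- Quantitative variant of stub S4′-2 (slice-averaged complex deficit bound `≤ C/(c₀K)·Re Z`, `r ≥ 2`; S4-2 of the
previous registration; glue p120430). -/
def ComplexSliceDeficit : Prop :=
  ∀ (r : ℕ) (B c₀ : ℝ), 2 ≤ r → 0 < c₀ → ∃ K₀ : ℝ, ∃ L₀ : ℕ, ∃ C : ℝ, ∀ K : ℝ, K₀ ≤ K → ∀ c : ((Fin r × Fin r × Fin r) → ℤ) →₀ ℂ, (∀ n ∈ c.support, ∑ w, n w = 0) → c.sum (fun _ a => a) = 0 → c.sum (fun n a => ‖a‖ * Real.exp (∑ w, |(n w : ℝ)|)) ≤ B → (∀ φ : (Fin r × Fin r × Fin r) → ℝ, c₀ * ∑ w, ∑ w', (1 - Real.cos (φ w - φ w')) ≤ ((fun (φ : (Fin r × Fin r × Fin r) → ℝ) => c.sum (fun n a => a * Complex.exp (Complex.I * ((∑ w, (n w : ℝ) * φ w : ℝ) : ℂ)))) φ).re) → (∀ n : (Fin r × Fin r × Fin r) → ℤ, c (fun w => n (w.1, w.2.1, Fin.rev w.2.2)) = (starRingEnd ℂ) (c (-n))) → (∀ n : (Fin r × Fin r ×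 Fin r) → ℤ, c (fun w => n (Fin.rev w.1, Fin.rev w.2.1, w.2.2)) = c n) → ∀ (L M : ℕ) [NeZero L] [NeZero M], L₀ ≤ L → L ≤ M → Even L → Even M → let sh : (Literature.Probability.LatticeModels.TorusSite 2 L × ZMod M) → (Fin r × Fin r × Fin r) → (Literature.Probability.LatticeModels.TorusSite 2 L × ZMod M) := fun s w => (s.1 + ![((w.1 : ℕ) : ZMod L), ((w.2.1 : ℕ) : ZMod L)], s.2 + ((w.2.2 : ℕ) : ZMod M)); let F : ((Fin r × Fin r × Fin r) → ℝ) → ℂ := fun (φ : (Fin r × Fin r × Fin r) → ℝ) => c.sum (fun n a => a * Complex.exp (Complex.I * ((∑ w, (n w : ℝ) * φ w : ℝ) : ℂ))); let A : ((Literature.Probability.LatticeModels.TorusSite 2 L × ZMod M) → ℝ) → ℂ := fun θ => (K : ℂ) * ∑ s : (Literature.Probability.LatticeModels.TorusSite 2 L × ZMod M), F (fun w => θ (sh s w)); let cube : Set ((Literature.Probability.LatticeModels.TorusSite 2 L × ZMod M) → ℝ) := Set.pi Set.univ (fun _ => Set.Icc (0:ℝ) (2 * Real.pi)); let Z : ℂ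 := MeasureTheory.integral (MeasureTheory.volume.restrict cube) (fun θ => Complex.exp (-(A θ))); (MeasureTheory.integral (MeasureTheory.volume.restrict cube) (fun θ => (((∑ x : Literature.Probability.LatticeModels.TorusSite 2 L, ∑ y : Literature.Probability.LatticeModels.TorusSite 2 L, (1 - Real.cos (θ (x, 0) - θ (y, 0)))) / (L : ℝ) ^ 4 : ℝ) : ℂ) * Complex.exp (-(A θ)))).re ≤ C / (c₀ * K) * Z.re

/-- Item-ready form of stub S4′-2 (slice-averaged complex deficit at the crux's threshold `1/2`, `r ≥ 2`): EQUIVALENT,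
given `ComplexPositivityR3` + the landed `r = 2` positivity, to conjunct 2 of the crux. -/
def ComplexSliceOrderHalf : Prop :=
  ∀ (r : ℕ) (B c₀ : ℝ), 2 ≤ r → 0 < c₀ → ∃ K₀ : ℝ, ∃ L₀ : ℕ, ∀ K : ℝ, K₀ ≤ K → ∀ c : ((Fin r × Fin r × Fin r) → ℤ) →₀ ℂ, (∀ n ∈ c.support, ∑ w, n w = 0) → c.sum (fun _ a => a) = 0 → c.sum (fun n a => ‖a‖ * Real.exp (∑ w, |(n w : ℝ)|)) ≤ B → (∀ φ : (Fin r × Fin r × Fin r) → ℝ, c₀ * ∑ w, ∑ w', (1 - Real.cos (φ w - φ w')) ≤ ((fun (φ : (Fin r × Fin r × Fin r) → ℝ) => c.sum (fun n a => a * Complex.exp (Complex.I * ((∑ w, (n w : ℝ) * φ w : ℝ) : ℂ)))) φ).re) → (∀ n : (Fin r × Fin r × Fin r) → ℤ, c (fun w => n (w.1, w.2.1, Fin.rev w.2.2)) = (starRingEnd ℂ) (c (-n))) → (∀ n : (Fin r × Fin r × Fin r) → ℤ, c (fun w => n (Fin.rev w.1, Fin.rev w.2.1, w.2.2)) = c n)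 → ∀ (L M : ℕ) [NeZero L] [NeZero M], L₀ ≤ L → L ≤ M → Even L → Even M → let sh : (Literature.Probability.LatticeModels.TorusSite 2 L × ZMod M) → (Fin r × Fin r × Fin r) → (Literature.Probability.LatticeModels.TorusSite 2 L × ZMod M) := fun s w => (s.1 + ![((w.1 : ℕ) : ZMod L), ((w.2.1 : ℕ) : ZMod L)], s.2 + ((w.2.2 : ℕ) : ZMod M)); let F : ((Fin r × Fin r × Fin r) → ℝ) → ℂ := fun (φ : (Fin r × Fin r × Fin r) → ℝ) => c.sum (fun n a => a * Complex.exp (Complex.I * ((∑ w, (n w : ℝ) * φ w : ℝ) : ℂ))); let A : ((Literature.Probability.LatticeModels.TorusSite 2 L × ZMod M) → ℝ) → ℂ := fun θ => (K : ℂ) * ∑ s : (Literature.Probability.LatticeModels.TorusSite 2 L × ZMod M), F (fun w => θ (sh s w)); let cube : Set ((Literature.Probability.LatticeModels.TorusSite 2 L × ZMod M) → ℝ) := Set.pi Set.univ (fun _ => Set.Icc (0:ℝ) (2 * Real.pi)); let Z : ℂ := MeasureTheory.integral (MeasureTheory.volume.restrict cube) (fun θ => Complex.exp (-(A θ))); (MeasureTheory.integral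 (MeasureTheory.volume.restrict cube) (fun θ => (((∑ x : Literature.Probability.LatticeModels.TorusSite 2 L, ∑ y : Literature.Probability.LatticeModels.TorusSite 2 L, (1 - Real.cos (θ (x, 0) - θ (y, 0)))) / (L : ℝ) ^ 4 : ℝ) : ℂ) * Complex.exp (-(A θ)))).re ≤ (1/2 : ℝ) * Z.re

/-- `ComplexSliceOrderHalf` is literally stub S4′-2. -/
theorem complexSliceOrderHalf_iff : ComplexSliceOrderHalf ↔ (∀ (r : ℕ) (B c₀ : ℝ), 2 ≤ r → 0 < c₀ → ∃ K₀ : ℝ, ∃ L₀ : ℕ, ∀ K : ℝ, K₀ ≤ K → ∀ c : Table r, (∀ n ∈ c.support, ∑ w, n w = 0) → c.sum (fun _ a => a) = 0 → normA c ≤ B → (∀ φ : W r → ℝ, c₀ * ∑ w, ∑ w', (1 - Real.cos (φ w - φ w')) ≤ (genF c φ).re) → (∀ n : Freq r, c (fun w => n (w.1, w.2.1, Fin.rev w.2.2)) = (starRingEnd ℂ) (c (-n))) → (∀ n : Freq r, c (fun w => n (Fin.rev w.1, Fin.rev w.2.1, w.2.2)) = c n) → ∀ (L M : ℕ) [NeZero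 L] [NeZero M], L₀ ≤ L → L ≤ M → Even L → Even M → (∫ θ in cube L M, (((∑ x : TorusSite 2 L, ∑ y : TorusSite 2 L, (1 - Real.cos (θ (x, 0) - θ (y, 0)))) / (L : ℝ) ^ 4 : ℝ) : ℂ) * Complex.exp (-(action K c L M θ))).re ≤ (1/2 : ℝ) * (partZ K c L M).re) :=
  Iff.rfl

/-- The REAL FACE (lead a2's `stub_modulusSliceOrder` conclusion): slice two-point deficit of the positive modulus
measure `e^{−Re A}dθ` of every coercive table, `≤ C₂/(c₀K)` uniformly in `r ≤ L ≤ M`. -/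
def RealFaceSliceOrder : Prop :=
  ∀ (r : ℕ) (B c₀ : ℝ), 2 ≤ r → 0 < c₀ → ∃ K₂ C₂ : ℝ, ∀ K : ℝ, K₂ ≤ K → ∀ c : ((Fin r × Fin r × Fin r) → ℤ) →₀ ℂ, (∀ n ∈ c.support, ∑ w, n w = 0) → c.sum (fun _ a => a) = 0 → c.sum (fun n a => ‖a‖ * Real.exp (∑ w, |(n w : ℝ)|)) ≤ B → (∀ φ : (Fin r × Fin r × Fin r) → ℝ, c₀ * ∑ w, ∑ w', (1 - Real.cos (φ w - φ w')) ≤ ((fun (φ : (Fin r × Fin r × Fin r) → ℝ) => c.sum (fun n a => a * Complex.exp (Complex.I * ((∑ w, (n w : ℝ) * φ w : ℝ) : ℂ)))) φ).re) → ∀ (L M : ℕ) [NeZero L] [NeZero M], r ≤ L → L ≤ M → let sh : (Literature.Probability.LatticeModels.TorusSite 2 L × ZMod M) → (Fin r × Fin r × Fin r) → (Literature.Probability.LatticeModels.TorusSite 2 L × ZMod M) := fun s w => (s.1 + ![((w.1 : ℕ) : ZMod L), ((w.2.1 : ℕ) : ZMod L)], s.2 + ((w.2.2 : ℕ) : ZMod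 M)); let F : ((Fin r × Fin r × Fin r) → ℝ) → ℂ := fun (φ : (Fin r × Fin r × Fin r) → ℝ) => c.sum (fun n a => a * Complex.exp (Complex.I * ((∑ w, (n w : ℝ) * φ w : ℝ) : ℂ))); let A : ((Literature.Probability.LatticeModels.TorusSite 2 L × ZMod M) → ℝ) → ℂ := fun θ => (K : ℂ) * ∑ s : (Literature.Probability.LatticeModels.TorusSite 2 L × ZMod M), F (fun w => θ (sh s w)); let cube : Set ((Literature.Probability.LatticeModels.TorusSite 2 L × ZMod M) → ℝ) := Set.pi Set.univ (fun _ => Set.Icc (0:ℝ) (2 * Real.pi)); ∀ x y : Literature.Probability.LatticeModels.TorusSite 2 L, MeasureTheory.integral (MeasureTheory.volume.restrict cube) (fun θ => (1 - Real.cos (θ (x, 0) - θ (y, 0))) * Real.exp (-(A θ).re)) ≤ C₂ / (c₀ * K) * MeasureTheory.integral (MeasureTheory.volume.restrict cube) (fun θ => Real.exp (-(A θ).re))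

/-- `ComplexPositivityR3` is literally stub S4′-1. -/
theorem complexPositivityR3_iff : ComplexPositivityR3 ↔ (∀ (r : ℕ) (B c₀ : ℝ), 3 ≤ r → 0 < c₀ → ∃ K₀ : ℝ, ∃ L₀ : ℕ, ∀ K : ℝ, K₀ ≤ K → ∀ c : Table r, (∀ n ∈ c.support, ∑ w, n w = 0) → c.sum (fun _ a => a) = 0 → normA c ≤ B → (∀ φ : W r → ℝ, c₀ * ∑ w, ∑ w', (1 - Real.cos (φ w - φ w')) ≤ (genF c φ).re) → (∀ n : Freq r, c (fun w => n (w.1, w.2.1, Fin.rev w.2.2)) = (starRingEnd ℂ) (c (-n))) → (∀ n : Freq r, c (fun w => n (Fin.rev w.1, Fin.rev w.2.1, w.2.2)) = c n) → ∀ (L M : ℕ) [NeZero L] [NeZero M], L₀ ≤ L → L ≤ M → Even L → Even M → 0 < (partZ K c L M).re) :=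
  Iff.rfl

/-- `ComplexSliceDeficit` in the `WitnessTable` vocabulary. -/
theorem complexSliceDeficit_iff : ComplexSliceDeficit ↔ (∀ (r : ℕ) (B c₀ : ℝ), 2 ≤ r → 0 < c₀ → ∃ K₀ : ℝ, ∃ L₀ : ℕ, ∃ C : ℝ, ∀ K : ℝ, K₀ ≤ K → ∀ c : Table r, (∀ n ∈ c.support, ∑ w, n w = 0) → c.sum (fun _ a => a) = 0 → normA c ≤ B → (∀ φ : W r → ℝ, c₀ * ∑ w, ∑ w', (1 - Real.cos (φ w - φ w')) ≤ (genF c φ).re) → (∀ n : Freq r, c (fun w => n (w.1, w.2.1, Fin.rev w.2.2)) = (starRingEnd ℂ) (c (-n))) → (∀ n : Freq r, c (fun w => n (Fin.rev w.1, Fin.rev w.2.1, w.2.2)) = c n) → ∀ (L M : ℕ) [NeZero L] [NeZero M], L₀ ≤ L → L ≤ M → Even L → Even M → (∫ θ in cube L M, (((∑ x : TorusSite 2 L, ∑ y : TorusSite 2 L, (1 - Real.cos (θ (x, 0) - θ (y, 0)))) / (L : ℝ) ^ 4 : ℝ) : ℂ) * Complex.exp (-(action K c L M θ))).re ≤ C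 / (c₀ * K) * (partZ K c L M).re) :=
  Iff.rfl

/-- Conversely the crux implies `ComplexPositivityR3` (hidden positivity, landed): the split's first child is a
face of the crux. -/
theorem complexPositivityR3_of_crux (h : BirComplexStableXYR) : ComplexPositivityR3 := by
  refine complexPositivityR3_iff.mpr ?_
  intro r B c₀ hr hc₀
  obtain ⟨K₀, L₀, H⟩ := complexPositivity_of_crux h r B c₀ (by omega) hc₀
  refine ⟨K₀, L₀, ?_⟩
  intro K hK c hU1 hN hA hC hR hP L M _ _ hL0 hLM hLe hMe
  exact (H K hK c hU1 hN hA hC hR hP L M hL0 hLM hLe hMe).1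

/-! ## The split is an EQUIVALENCE: `crux ↔ ComplexPositivityR3 ∧ ComplexSliceOrderHalf` (checked) -/

section Equivalence

variable {r : ℕ}

/-- The numerator identity `∫ O·e^{−A} = Z − ∫ D·e^{−A}` on the cube (`O = 1 − D` pointwise, `sg_sliceObs_eq`;
integrability from (C) with `K, c₀ ≥ 0`). [folklore] -/
theorem integral_sliceObs_eq_sub {K c₀ : ℝ} (hK : 0 ≤ K) (hc₀ : 0 ≤ c₀) (c : Table r)
    (hC : ∀ φ : W r → ℝ, c₀ * ∑ w, ∑ w', (1 - Real.cos (φ w - φ w')) ≤ (genF c φ).re)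
    (L M : ℕ) [NeZero L] [NeZero M] :
    (∫ θ in cube L M, (((‖∑ x : TorusSite 2 L, Complex.exp (Complex.I * (θ (x, 0) : ℂ))‖ ^ 2 / (L : ℝ) ^ 4 : ℝ)) : ℂ) * Complex.exp (-(action K c L M θ))) =
      partZ K c L M - ∫ θ in cube L M, (((∑ x : TorusSite 2 L, ∑ y : TorusSite 2 L, (1 - Real.cos (θ (x, 0) - θ (y, 0)))) / (L : ℝ) ^ 4 : ℝ) : ℂ) * Complex.exp (-(action K c L M θ)) := by
  have hwc : Continuous (fun θ : Λ L M → ℝ => Complex.exp (-(action K c L M θ))) := sg_continuous_weight K c (sh L M)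
  have hwb : ∀ θ : Λ L M → ℝ, ‖Complex.exp (-(action K c L M θ))‖ ≤ 1 := sg_norm_weight_le_one hK hc₀ c hC (sh L M)
  have hcard : (Fintype.card (TorusSite 2 L) : ℝ) = (L : ℝ) ^ 2 := by simp [TorusSite, ZMod.card]
  have hL : (0 : ℝ) < L := by exact_mod_cast Nat.pos_of_ne_zero (NeZero.ne L)
  have hint1 : Integrable (fun θ : Λ L M → ℝ => (1 : ℂ) * Complex.exp (-(action K c L M θ))) (volume.restrict (cube L M)) :=
    sg_integrable_mul_weight _ hwc hwb (fun _ => (1 : ℂ)) continuous_const 1 (fun _ => by simp)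
  have hint0 : Integrable (fun θ : Λ L M → ℝ => Complex.exp (-(action K c L M θ))) (volume.restrict (cube L M)) := by
    simpa using hint1
  have hintD : Integrable (fun θ : Λ L M → ℝ => (((∑ x : TorusSite 2 L, ∑ y : TorusSite 2 L, (1 - Real.cos (θ (x, 0) - θ (y, 0)))) / (L : ℝ) ^ 4 : ℝ) : ℂ) * Complex.exp (-(action K c L M θ)))
      (volume.restrict (cube L M)) := by
    refine sg_integrable_mul_weight _ hwc hwb _ ?_ 2 (fun θ => ?_)
    · refine Complex.continuous_ofReal.comp ?_
      refine Continuous.div_const ?_ _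
      exact continuous_finsetSum _ fun x _ => continuous_finsetSum _ fun y _ =>
        continuous_const.sub (Real.continuous_cos.comp ((continuous_apply _).sub (continuous_apply _)))
    · have h0 : 0 ≤ (∑ x : TorusSite 2 L, ∑ y : TorusSite 2 L, (1 - Real.cos (θ (x, 0) - θ (y, 0)))) / (L : ℝ) ^ 4 :=
        div_nonneg (Finset.sum_nonneg fun x _ => Finset.sum_nonneg fun y _ =>
          sub_nonneg.2 (Real.cos_le_one _)) (by positivity)
      have h1 : (∑ x : TorusSite 2 L, ∑ y : TorusSite 2 L, (1 - Real.cos (θ (x, 0) - θ (y, 0)))) / (L : ℝ) ^ 4 ≤ 2 := by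
        have hL4 : (0 : ℝ) < (L : ℝ) ^ 4 := by positivity
        rw [div_le_iff₀ hL4]
        calc (∑ x : TorusSite 2 L, ∑ y : TorusSite 2 L, (1 - Real.cos (θ (x, 0) - θ (y, 0))))
            ≤ ∑ _x : TorusSite 2 L, ∑ _y : TorusSite 2 L, (2 : ℝ) :=
              Finset.sum_le_sum fun x _ => Finset.sum_le_sum fun y _ => by
                linarith [Real.neg_one_le_cos (θ (x, 0) - θ (y, 0))]
          _ = 2 * (L : ℝ) ^ 4 := by
              simp only [Finset.sum_const, Finset.card_univ, nsmul_eq_mul, hcard]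
              ring
      rw [Complex.norm_real, Real.norm_eq_abs, abs_of_nonneg h0]
      exact h1
  have hpt : ∀ θ : Λ L M → ℝ, (((‖∑ x : TorusSite 2 L, Complex.exp (Complex.I * (θ (x, 0) : ℂ))‖ ^ 2 / (L : ℝ) ^ 4 : ℝ)) : ℂ) * Complex.exp (-(action K c L M θ)) =
      Complex.exp (-(action K c L M θ)) - (((∑ x : TorusSite 2 L, ∑ y : TorusSite 2 L, (1 - Real.cos (θ (x, 0) - θ (y, 0)))) / (L : ℝ) ^ 4 : ℝ) : ℂ) * Complex.exp (-(action K c L M θ)) := by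
    intro θ
    rw [sg_sliceObs_eq L (fun x => θ (x, 0))]
    push_cast
    ring
  calc (∫ θ in cube L M, (((‖∑ x : TorusSite 2 L, Complex.exp (Complex.I * (θ (x, 0) : ℂ))‖ ^ 2 / (L : ℝ) ^ 4 : ℝ)) : ℂ) * Complex.exp (-(action K c L M θ)))
      = ∫ θ in cube L M, (Complex.exp (-(action K c L M θ)) - (((∑ x : TorusSite 2 L, ∑ y : TorusSite 2 L, (1 - Real.cos (θ (x, 0) - θ (y, 0)))) / (L : ℝ) ^ 4 : ℝ) : ℂ) * Complex.exp (-(action K c L M θ))) :=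
        integral_congr_ae (Filter.Eventually.of_forall fun θ => hpt θ)
    _ = (∫ θ in cube L M, Complex.exp (-(action K c L M θ))) - ∫ θ in cube L M, (((∑ x : TorusSite 2 L, ∑ y : TorusSite 2 L, (1 - Real.cos (θ (x, 0) - θ (y, 0)))) / (L : ℝ) ^ 4 : ℝ) : ℂ) * Complex.exp (-(action K c L M θ)) :=
        integral_sub hint0 hintD
    _ = partZ K c L M - ∫ θ in cube L M, (((∑ x : TorusSite 2 L, ∑ y : TorusSite 2 L, (1 - Real.cos (θ (x, 0) - θ (y, 0)))) / (L : ℝ) ^ 4 : ℝ) : ℂ) * Complex.exp (-(action K c L M θ)) := rfl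

/-- **Conversely the crux implies `ComplexSliceOrderHalf`** (hidden positivity `birComplexStableXYR_pos`: `0 < Re Z` and
`½ ≤ Re ∫ O e^{−A} / Re Z`; then `Re ∫ D e^{−A} = Re Z − Re ∫ O e^{−A} ≤ ½ Re Z`).  Threshold `max K₀ 0`. [folklore] -/
theorem complexSliceOrderHalf_of_crux (h : BirComplexStableXYR) : ComplexSliceOrderHalf := by
  refine complexSliceOrderHalf_iff.mpr ?_
  intro r B c₀ hr hc₀
  obtain ⟨K₀, L₀, H⟩ := birComplexStableXYR_pos h r B c₀ hr hc₀
  refine ⟨max K₀ 0, L₀, ?_⟩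
  intro K hK c hU1 hN hA hC hR hP L M _ _ hL0 hLM hLe hMe
  have hK₀ : K₀ ≤ K := le_trans (le_max_left _ _) hK
  have hK0 : 0 ≤ K := le_trans (le_max_right _ _) hK
  have key := H K hK₀ c hU1 hN hA hC hR hP L M hL0 hLM hLe hMe
  dsimp only at key
  obtain ⟨hZpos, -, hhalf⟩ := key
  have hZpos' : 0 < (partZ K c L M).re := by
    dsimp only [partZ, action, genF, sh, cube]; exact hZpos
  have hhalf' : (1/2 : ℝ) ≤ (∫ θ in cube L M, (((‖∑ x : TorusSite 2 L, Complex.exp (Complex.I * (θ (x, 0) : ℂ))‖ ^ 2 /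
      (L : ℝ) ^ 4 : ℝ)) : ℂ) * Complex.exp (-(action K c L M θ))).re / (partZ K c L M).re := by
    dsimp only [partZ, action, genF, sh, cube]; exact hhalf
  have hid := integral_sliceObs_eq_sub hK0 hc₀.le c hC L M
  rw [le_div_iff₀ hZpos'] at hhalf'
  have hre : (∫ θ in cube L M, (((∑ x : TorusSite 2 L, ∑ y : TorusSite 2 L,
        (1 - Real.cos (θ (x, 0) - θ (y, 0)))) / (L : ℝ) ^ 4 : ℝ) : ℂ) * Complex.exp (-(action K c L M θ))).re =
      (partZ K c L M).re - (∫ θ in cube L M, (((‖∑ x : TorusSite 2 L, Complex.exp (Complex.I * (θ (x, 0) : ℂ))‖ ^ 2 /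
        (L : ℝ) ^ 4 : ℝ)) : ℂ) * Complex.exp (-(action K c L M θ))).re := by
    rw [hid, Complex.sub_re]; ring
  rw [hre]
  linarith

/-- **The S4′ split is an equivalence (checked):** the crux `BalabanIR.BirComplexStableXYR` holds iff both promoted
children hold — `ComplexPositivityR3` (`r ≥ 3` real-part positivity) and `ComplexSliceOrderHalf` (slice-averaged deficit
`≤ ½ Re Z`).  `→`: hidden positivity (`complexPositivityR3_of_crux`, `complexSliceOrderHalf_of_crux`); `←`: the landed glue
(`Theorems.stub_splitGlueHalf`, here its in-file copy `splitGlueHalf'`). -/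
theorem birComplexStableXYR_iff_children : BirComplexStableXYR ↔ (ComplexPositivityR3 ∧ ComplexSliceOrderHalf) := by
  constructor
  · exact fun h => ⟨complexPositivityR3_of_crux h, complexSliceOrderHalf_of_crux h⟩
  · rintro ⟨h1, h2⟩
    exact splitGlueHalf' h1 h2

end Equivalence

end Summit.HubbardSuperconductivity.HubbardSuperconductivity.Cruxes.BirComplexStableXYR.Lines.LogConcaveCoreBoundedPhase

end
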